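import Summits.Langlands.Langlands.Theorems.SkinnerWilesDefectOneFiveIsogenyEllipticCurvesOrdinaryAlgebra
import HarnessLib

/-!
# The ordinary line of the Tate module from the receptacles (Serre 1968, IV A.2.2)
(route `SkinnerWilesDefectOne`, item stmt-Langlands-12922 `FiveIsogenyEllipticCurves`, helper)

Let `E/K` be an elliptic curve, `ℓ` a prime, `T = T_ℓ E` (free of rank two over `ℤ_ℓ`) with its
Galois action `ρ`, and `I ≤ Γ_K` a subgroup admitting RECEPTACLES: for every `m` a subgroup
`X ≤ E[ℓᵐ]` with `#X ≤ ℓᵐ` containing `P^τ - P` for all `τ ∈ I`, `P ∈ E[ℓᵐ]` (for the inertia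
group at a good ordinary place above `ℓ` these are the groups `E[ℓᵐ] ∩ E₁`,
`…Receptacle.exists_receptacle`).  Let `τ₀ ∈ I` act on `T` with determinant `u₀ ≢ 1 (mod ℓ)` and
with `ρ(τ₀) - 1` not surjective on `V = ℚ_ℓ ⊗ T` (for inertia: `det = χ_ℓ(τ₀)`, and the tree's
`not_surjective_rationalGaloisRepTate_sub_one`).  Then (`sub_mem_ker_of_receptacle`)

  **for every `τ ∈ I`, `(ρ(τ) - 1) T ⊆ T_u := ker (ρ(τ₀) - u₀)`,**

i.e. the line `T_u` (Serre's `X = T_ℓ(Ê)`, the kernel of reduction) is stable under `I`, which acts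
trivially on `T / T_u`.  Proof: `T = T₁ ⊕ T_u` (`T₁ = ker (ρ(τ₀) - 1)`; Cayley–Hamilton with
`u₀ - 1 ∈ ℤ_ℓˣ`, `…OrdinaryAlgebra`), `T_u = (ρ(τ₀) - 1) T` contains some `z ∉ ℓ T`
(`dvd_det_sub_one_of_forall`); if `y = ρ(τ)x - x` had a component `y₁ ≠ 0` in `T₁`, say
`y₁ ∉ ℓⁿ T`, the receptacle at level `n` would contain the reductions of `ℤ_ℓ z + ℤ_ℓ y₁`, which
has `≥ ℓⁿ · ℓ > ℓⁿ` elements (`card_le_of_two_directions`).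

References: J.-P. Serre, *Abelian ℓ-adic representations and elliptic curves* (1968), IV A.2.2;
J. H. Silverman, *The Arithmetic of Elliptic Curves* (2009), VII.2–3.
-/

noncomputable section

-- `Summit.Langlands.Langlands.…`: summit = sub-problem name (D-0017 layout), as in every Theorems file here.
set_option linter.dupNamespace false

open Literature.NumberTheory.EllipticCurves Literature.NumberTheory.EllipticCurves.TateModule
open WeierstrassCurve Field

namespace Summit.Langlands.Langlands.Theorems.FiveIsogenyEllipticCurves

universe u

/-! ### Counting two independent directions inside a receptacle -/

section Counting

variable {A : Type u} [AddCommGroup A] {ℓ : ℕ} [hℓ : Fact ℓ.Prime]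

/-- **Two independent directions modulo `ℓⁿ` are too many.**  Let `π₁, π_u` be `ℤ_ℓ`-linear
endomorphisms of `T_ℓ A` ("projections": used only through `π_u z = z`, `π₁ z = 0`, `π_u y = 0`,
`π₁ y = y`), `z ∉ ℓ T_ℓ A` and `y ∉ ℓⁿ T_ℓ A` (`projₙ y ≠ 0`).  If a finite subgroup `X ≤ A`
contains the `n`-th components of all `ℤ_ℓ`-multiples of `z` and of `y`, then `#X ≥ ℓⁿ · ℓ`:
the map `(i, j) ↦ projₙ (i z + j y)`, `0 ≤ i < ℓⁿ`, `0 ≤ j < ℓ`, is injective (apply `π_u`, `π₁`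
to a coincidence and use `…OrdinaryAlgebra.exists_(pow_)smul_of_natCast_smul_eq_pow_smul`).
[folklore] -/
theorem card_le_of_two_directions {n : ℕ} (πu π1 : TateModule A ℓ →ₗ[ℤ_[ℓ]] TateModule A ℓ)
    {z y : TateModule A ℓ} (hzu : πu z = z) (hz1 : π1 z = 0) (hyu : πu y = 0) (hy1 : π1 y = y)
    (hz : ¬ ∃ s : TateModule A ℓ, (ℓ : ℤ_[ℓ]) • s = z) (hy : proj ℓ n y ≠ 0)
    {X : AddSubgroup A} [Finite X] (hXz : ∀ c : ℤ_[ℓ], proj ℓ n (c • z) ∈ X)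
    (hXy : ∀ c : ℤ_[ℓ], proj ℓ n (c • y) ∈ X) : ℓ ^ n * ℓ ≤ Nat.card X := by
  let f : Fin (ℓ ^ n) × Fin ℓ → X := fun ij =>
    ⟨proj ℓ n (((ij.1 : ℕ) : ℤ_[ℓ]) • z + ((ij.2 : ℕ) : ℤ_[ℓ]) • y), by
      rw [_root_.map_add]; exact X.add_mem (hXz _) (hXy _)⟩
  have hf : Function.Injective f := by
    rintro ⟨i, j⟩ ⟨i', j'⟩ hij
    have h0 : proj ℓ n ((((i : ℕ) : ℤ_[ℓ]) • z + ((j : ℕ) : ℤ_[ℓ]) • y) -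
        ((((i' : ℕ) : ℤ_[ℓ]) • z + ((j' : ℕ) : ℤ_[ℓ]) • y))) = 0 := by
      rw [_root_.map_sub, sub_eq_zero]
      exact congrArg Subtype.val hij
    obtain ⟨s, hs⟩ := (proj_eq_zero_iff_exists_pow_smul n _).mp h0
    -- apply the two projections
    have hu := congrArg πu hs
    have h1 := congrArg π1 hs
    simp only [map_smul, _root_.map_sub, _root_.map_add, hzu, hz1, hyu, hy1, smul_zero, add_zero, zero_add] at hu h1
    -- `hu : ℓⁿ • πu s = (i - i') • z`, `h1 : ℓⁿ • π1 s = (j - j') • y`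
    have hi : (i : ℕ) = i' := by
      by_contra hne
      rcases Nat.lt_or_gt_of_ne hne with hlt | hlt
      · -- `(i' - i) • z = ℓⁿ • (-πu s)`
        have e : (((i' : ℕ) - i : ℕ) : ℤ_[ℓ]) • z = (ℓ : ℤ_[ℓ]) ^ n • (-πu s) := by
          rw [smul_neg, hu, Nat.cast_sub hlt.le, sub_smul, neg_sub]
        exact hz (exists_smul_of_natCast_smul_eq_pow_smul (by omega) (by omega) e)
      · have e : (((i : ℕ) - i' : ℕ) : ℤ_[ℓ]) • z = (ℓ : ℤ_[ℓ]) ^ n • πu s := by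
          rw [hu, Nat.cast_sub hlt.le, sub_smul]
        exact hz (exists_smul_of_natCast_smul_eq_pow_smul (by omega) (by omega) e)
    have hj : (j : ℕ) = j' := by
      by_contra hne
      rcases Nat.lt_or_gt_of_ne hne with hlt | hlt
      · have e : (((j' : ℕ) - j : ℕ) : ℤ_[ℓ]) • y = (ℓ : ℤ_[ℓ]) ^ n • (-π1 s) := by
          rw [smul_neg, h1, Nat.cast_sub hlt.le, sub_smul, neg_sub]
        obtain ⟨s', hs'⟩ := exists_pow_smul_of_natCast_smul_eq_pow_smul (by omega) (by omega) e
        exact hy (by rw [← hs', proj_pow_smul, pow_smul_proj])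
      · have e : (((j : ℕ) - j' : ℕ) : ℤ_[ℓ]) • y = (ℓ : ℤ_[ℓ]) ^ n • π1 s := by
          rw [h1, Nat.cast_sub hlt.le, sub_smul]
        obtain ⟨s', hs'⟩ := exists_pow_smul_of_natCast_smul_eq_pow_smul (by omega) (by omega) e
        exact hy (by rw [← hs', proj_pow_smul, pow_smul_proj])
    exact Prod.ext (Fin.ext hi) (Fin.ext hj)
  have hcard := Nat.card_le_card_of_injective f hf
  rwa [Nat.card_prod, Nat.card_eq_fintype_card, Fintype.card_fin, Nat.card_eq_fintype_card,
    Fintype.card_fin] at hcard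

end Counting

/-! ### Elliptic curves: the ordinary line -/

section Elliptic

variable {K : Type u} [Field K] (W : WeierstrassCurve K) [W.IsElliptic] (ℓ : ℕ) [hℓ : Fact ℓ.Prime]

omit [W.IsElliptic] in
/-- Components of `ρ(σ) x - x`: `projₘ (ρ(σ) x - x) = σ • projₘ x - projₘ x`. [folklore] -/
theorem proj_galoisRepTate_sub' (σ : absoluteGaloisGroup K) (x : W.tateModule ℓ) (m : ℕ) :
    proj ℓ m (W.galoisRepTate ℓ σ x - x) = σ • proj ℓ m x - proj ℓ m x := by
  rw [_root_.map_sub, galoisRepTate_apply_apply, proj_smul_of_distribMulAction]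

/-- **A generator of the ordinary line outside `ℓ T`.**  With `g = ρ(τ₀)` of determinant `u₀`,
`u₀ ≢ 1 (mod ℓ)`, and `(g - u₀) ∘ (g - 1) = 0`: some `z = g x' - x'` lies in `ker (g - u₀)` but not
in `ℓ T` (otherwise `(g - 1) T ⊆ ℓ T` and `ℓ ∣ det g - 1 = u₀ - 1`, `dvd_det_sub_one_of_forall`).
[folklore] -/
theorem exists_generator_not_dvd (hℓK : (ℓ : K) ≠ 0) {τ₀ : absoluteGaloisGroup K} {u₀ : ℤ_[ℓ]}
    (hdet : LinearMap.det (W.galoisRepTate ℓ τ₀) = u₀) (hu₀ : ¬ (ℓ : ℤ_[ℓ]) ∣ u₀ - 1)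
    (hC : ∀ x, (W.galoisRepTate ℓ τ₀ - u₀ • 1) ((W.galoisRepTate ℓ τ₀ - 1) x) = 0) :
    ∃ z x' : W.tateModule ℓ, z = W.galoisRepTate ℓ τ₀ x' - x' ∧
      (W.galoisRepTate ℓ τ₀ - u₀ • 1) z = 0 ∧ ¬ ∃ s : W.tateModule ℓ, (ℓ : ℤ_[ℓ]) • s = z := by
  haveI := module_free_tateModule_holds W ℓ
  haveI := module_finite_tateModule_holds W ℓ
  let b : Module.Basis (Fin 2) ℤ_[ℓ] (W.tateModule ℓ) :=
    Module.finBasisOfFinrankEq ℤ_[ℓ] (W.tateModule ℓ) (finrank_tateModule_eq_two_holds W ℓ hℓK)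
  by_contra hall
  push Not at hall
  apply hu₀
  rw [← hdet]
  refine dvd_det_sub_one_of_forall b _ fun j => ?_
  have h := hall (W.galoisRepTate ℓ τ₀ (b j) - b j) (b j) rfl (hC (b j))
  exact h

/-- **The ordinary line is stable under `I`, which acts trivially modulo it** (Serre 1968,
IV A.2.2, abstract form).  For a subgroup `I ≤ Γ_K` admitting receptacles of size `≤ ℓᵐ` at every
level `m`, and `τ₀ ∈ I` acting on `T_ℓ E` with determinant `u₀ ≢ 1 (mod ℓ)` and with `ρ(τ₀) - 1`
not surjective on `V_ℓ E`: for every `τ ∈ I` and `x ∈ T_ℓ E`,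
`(ρ(τ₀) - u₀) (ρ(τ) x - x) = 0`, i.e. `(ρ(τ) - 1) T_ℓ E ⊆ ker (ρ(τ₀) - u₀)`.
[cite: SerreAbelianLadic1968, IV A.2.2] -/
theorem sub_mem_ker_of_receptacle (hℓK : (ℓ : K) ≠ 0) {I : Subgroup (absoluteGaloisGroup K)}
    (hX : ∀ m : ℕ, ∃ X : AddSubgroup (geomPoints W), X ≤ geomTorsion W ((ℓ ^ m : ℕ) : ℤ) ∧
      Nat.card X ≤ ℓ ^ m ∧ ∀ τ ∈ I, ∀ P ∈ geomTorsion W ((ℓ ^ m : ℕ) : ℤ), τ • P - P ∈ X)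
    {τ₀ : absoluteGaloisGroup K} (hτ₀ : τ₀ ∈ I) {u₀ : ℤ_[ℓ]}
    (hdet : LinearMap.det (W.galoisRepTate ℓ τ₀) = u₀) (hu₀ : ¬ (ℓ : ℤ_[ℓ]) ∣ u₀ - 1)
    (hns : ¬ Function.Surjective
      (W.rationalGaloisRepTate ℓ τ₀ - 1 : Module.End ℚ_[ℓ] (W.rationalTateModule ℓ)))
    {τ : absoluteGaloisGroup K} (hτ : τ ∈ I) (x : W.tateModule ℓ) :
    (W.galoisRepTate ℓ τ₀ - u₀ • 1) (W.galoisRepTate ℓ τ x - x) = 0 := by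
  haveI := module_free_tateModule_holds W ℓ
  haveI := module_finite_tateModule_holds W ℓ
  have h2 := finrank_tateModule_eq_two_holds W ℓ hℓK
  set g : W.tateModule ℓ →ₗ[ℤ_[ℓ]] W.tateModule ℓ := W.galoisRepTate ℓ τ₀ with hg
  -- Cayley–Hamilton
  have hdet1 : LinearMap.det (g - 1) = 0 := det_sub_one_eq_zero_of_not_surjective g hns
  obtain ⟨hC1, hC2⟩ := comp_sub_smul_eq_zero_of_det h2 g hdet hdet1
  -- the unit `u₁ = u₀ - 1`
  have hu1 : IsUnit (u₀ - 1) := by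
    rw [PadicInt.isUnit_iff]
    refine le_antisymm (PadicInt.norm_le_one _) (not_lt.mp fun hlt => hu₀ ?_)
    exact (PadicInt.norm_lt_one_iff_dvd _).mp hlt
  obtain ⟨u₁, hu₁⟩ := hu1
  -- the projections `π_u = u₁⁻¹ (g - 1)`, `π₁ = u₁⁻¹ (u₀ - g)`
  set πu : W.tateModule ℓ →ₗ[ℤ_[ℓ]] W.tateModule ℓ := ((u₁⁻¹ : ℤ_[ℓ]ˣ) : ℤ_[ℓ]) • (g - 1) with hπu
  set π1 : W.tateModule ℓ →ₗ[ℤ_[ℓ]] W.tateModule ℓ := ((u₁⁻¹ : ℤ_[ℓ]ˣ) : ℤ_[ℓ]) • (u₀ • 1 - g)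
    with hπ1
  have hπu_apply : ∀ w, πu w = ((u₁⁻¹ : ℤ_[ℓ]ˣ) : ℤ_[ℓ]) • (g w - w) := fun w => rfl
  have hπ1_apply : ∀ w, π1 w = ((u₁⁻¹ : ℤ_[ℓ]ˣ) : ℤ_[ℓ]) • (u₀ • w - g w) := fun w => rfl
  have hsum : ∀ w, π1 w + πu w = w := by
    intro w
    have e : u₀ • w - w = (u₀ - 1) • w := by rw [sub_smul, one_smul]
    rw [hπu_apply, hπ1_apply, ← smul_add, sub_add_sub_cancel, e, ← hu₁, smul_smul, Units.inv_mul,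
      one_smul]
  -- kernels
  have hgu_apply : ∀ w, (g - u₀ • 1) w = g w - u₀ • w := fun w => rfl
  have hg1_apply : ∀ w, (g - 1) w = g w - w := fun w => rfl
  have hπu_ker : ∀ w, (g - u₀ • 1) (πu w) = 0 := by
    intro w
    rw [hπu_apply, map_smul, ← hg1_apply, hC2, smul_zero]
  have hπ1_ker : ∀ w, g (π1 w) = π1 w := by
    intro w
    have h := hC1 w
    rw [hg1_apply, sub_eq_zero, hgu_apply] at h
    rw [hπ1_apply, map_smul, ← neg_sub, _root_.map_neg, h]
  -- a generator `z` of the line outside `ℓ T`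
  obtain ⟨z, x', hzx, hzker, hzℓ⟩ := exists_generator_not_dvd W ℓ hℓK hdet hu₀ hC2
  have hzu : πu z = z := by
    rw [hgu_apply, sub_eq_zero] at hzker
    have e : u₀ • z - z = (u₀ - 1) • z := by rw [sub_smul, one_smul]
    rw [hπu_apply, hzker, e, ← hu₁, smul_smul, Units.inv_mul, one_smul]
  have hz1 : π1 z = 0 := by
    have h := hsum z
    rw [hzu, add_eq_right] at h
    exact h
  -- the element `y = ρ(τ)x - x` and its `T₁`-component
  set y := W.galoisRepTate ℓ τ x - x with hy
  have hyu : πu (π1 y) = 0 := by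
    rw [hπu_apply, hπ1_ker, sub_self, smul_zero]
  have hy11 : π1 (π1 y) = π1 y := by
    have h := hsum (π1 y)
    rw [hyu, add_zero] at h
    exact h
  -- it suffices that `π₁ y = 0`
  suffices h1 : π1 y = 0 by
    have h := hsum y
    rw [h1, zero_add] at h
    rw [← h]
    exact hπu_ker y
  by_contra hne
  -- a level `n` with `projₙ (π₁ y) ≠ 0`
  obtain ⟨n, hn⟩ : ∃ n, proj ℓ n (π1 y) ≠ 0 := by
    by_contra hall
    push Not at hall
    exact hne (TateModule.ext fun n => by rw [hall n, _root_.map_zero])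
  obtain ⟨X, hXle, hXcard, hXmem⟩ := hX n
  -- finiteness of `X ≤ E[ℓⁿ]`
  have hℓn0 : ((ℓ ^ n : ℕ) : ℤ) ≠ 0 := by exact_mod_cast pow_ne_zero n hℓ.out.ne_zero
  haveI : Finite (geomTorsion W ((ℓ ^ n : ℕ) : ℤ)) := finite_torsionPoints_holds W (AlgebraicClosure K) hℓn0
  haveI : Finite X := Finite.of_injective _ (AddSubgroup.inclusion_injective hXle)
  -- memberships
  have memA : ∀ w : W.tateModule ℓ, proj ℓ n (g w - w) ∈ X := by
    intro w
    rw [proj_galoisRepTate_sub']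
    exact hXmem τ₀ hτ₀ _ (proj_tateModule_mem_geomTorsion W ℓ n w)
  have memz : ∀ c : ℤ_[ℓ], proj ℓ n (c • z) ∈ X := by
    intro c
    have h := memA (c • x')
    rwa [map_smul, ← smul_sub, ← hzx] at h
  have memy : proj ℓ n y ∈ X := by
    rw [hy, proj_galoisRepTate_sub']
    exact hXmem τ hτ _ (proj_tateModule_mem_geomTorsion W ℓ n x)
  have memyu : proj ℓ n (πu y) ∈ X := by
    rw [hπu_apply, smul_sub, ← map_smul]
    exact memA _
  have memy1 : proj ℓ n (π1 y) ∈ X := by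
    have h := hsum y
    rw [← eq_sub_iff_add_eq] at h
    rw [h, _root_.map_sub]
    exact X.sub_mem memy memyu
  have memy1c : ∀ c : ℤ_[ℓ], proj ℓ n (c • π1 y) ∈ X := fun c => proj_smul_mem memy1 c
  -- counting
  have hge := card_le_of_two_directions πu π1 hzu hz1 hyu hy11 hzℓ hn memz memy1c
  have hℓ1 : 1 < ℓ := hℓ.out.one_lt
  have : ℓ ^ n * ℓ ≤ ℓ ^ n := hge.trans hXcard
  have hpos : 0 < ℓ ^ n := pow_pos hℓ.out.pos n
  nlinarith

end Elliptic

end Summit.Langlands.Langlands.Theorems.FiveIsogenyEllipticCurves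

end
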